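import Literature.AlgebraicGeometry.Resolution.ArithmeticalThreefoldsLocalDescentLayers
import Literature.AlgebraicGeometry.Resolution.InvariantsTrivialInertiaFixedModel
import Literature.AlgebraicGeometry.Resolution.InvariantsFixedModelFiniteness
import HarnessLib

/-!
# The inertia layer of [CoP1] Prop. 9.3 from a STABLE model: `(LU K′) ⇒ (LU Mˢ)` for `Mˢ ≤ K′ ≤ Mⁱ`

Topic: `Literature/AlgebraicGeometry/Resolution`. PROOF side of `CossartPiltant2019ReductionP`
(`ArithmeticalThreefoldsLocal.lean`), input (C4). `cossartPiltant2019ReductionP_of_cjs_of_layers`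
(`ArithmeticalThreefoldsLocalDescentLayers.lean`) left the inertia layer of [CoP1] Prop. 9.3 as
the hypothesis `hInert`: `(LU K′) ⇒ (LU Mˢ)` for `Mˢ ≤ K′ ≤ Mⁱ`. Its printed proof (HAL p. 27)
takes invariants of a regular local model of the inertia field under `Gˢ(W/V)/Gⁱ(W/V)`:

> the unique normal local model `S₀ⁱ` of `W ∩ Kⁱ/k` lying above `S₀′` is regular. Now, the
> invariant ring `S₀ˢ := (S₀ⁱ)^{Gˢ(W/V)/Gⁱ(W/V)} ⊂ Kˢ` is a normal local model of `Vˢ/k` …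
> `S₀ⁱ` is local-étale over `S₀ˢ`, so that `S₀ˢ` is regular

— silently using that `S₀ⁱ` is STABLE under `Gˢ` (as in Lemma 9.4, "S is stable by G"). This
file proves the inertia layer from exactly that: a `Gˢ`-stable regular local model on which
`Gˢ` acts with trivial inertia modulo its kernel (every `τ ∈ Gˢ` fixes the model pointwise or
moves some element of its local ring by a `v`-unit) descends to a regular local model of the
decomposition field `Mˢ` — by the étale descent of invariants
(`InvariantsTrivialInertiaDescent.lean`, `InvariantsTrivialInertiaFixedModel.lean`:
"`S₀ˢ` is regular") and E. Noether's finiteness (`InvariantsFixedModelFiniteness.lean`: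
"`S₀ˢ` is a MODEL of `Vˢ`").

* `exists_model_decompositionField_of_stableModel` — PROVED: in the climbing frame, a
  `Gˢ`-stable local uniformization (`t ⊆ N`, `Mˢ ⊆ Frac S[t]`, `(S[t])_𝔪` regular) with trivial
  inertia modulo kernel yields `(LU Mˢ)`;
* `cossartPiltant2019ReductionP_of_cjs_of_stableLayers` — PROVED:
  `CossartPiltant2019Local → CossartPiltant2019Principalization → CossartJannsenSaito2020General →
  (embedded resolution of surfaces) → (hStabLoc: "S is stable by G", tame layer) →
  (hStabInert: a stable model in the inertia layer) → (hDec: Prop. 9.3, decomposition layer) →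
  CossartPiltant2019ReductionP`.

After this file the transfer part (C3)+(C4)+(C5) of `Thm. 1.5 ⇒ Thm. 1.1` rests on `hDec`
([CoP1] Prop. 9.3 for `K′ ≤ Mˢ`, printed proof complete) and ONE unprinted principle in its two
instances `hStabLoc` (tame layer) and `hStabInert` (inertia layer): EQUIVARIANT local
uniformization — a local uniformization stable under a finite group fixing the valuation.

Everything is PROVED; no named facts, definitions, instances or notation are introduced.

## Sources

* V. Cossart, O. Piltant, J. Algebra 320 (2008) 1051–1082: Prop. 9.3 and its proof (HAL
  hal-00139124, pp. 26–28), Lemma 9.4 (p. 29). [CossartPiltant2008]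
* V. Cossart, O. Piltant, J. Algebra 529 (2019) 268–535 = arXiv:1412.0868, proof of Prop. 4.10
  (arXiv v1: Prop. 4.8, p. 54). [CossartPiltant2019]
-/

noncomputable section

open CategoryTheory AlgebraicGeometry TopologicalSpace IsLocalRing _root_.Polynomial
  _root_.IntermediateField

namespace Literature.AlgebraicGeometry.Resolution

universe u

section InertiaStable

variable {S E : Type u} [CommRing S] [Field E] [Algebra S E]

/-- **The inertia layer of [CoP1] Prop. 9.3 from a stable model** ("the invariant ring
`S₀ˢ := (S₀ⁱ)^{Gˢ/Gⁱ}` is a normal local model of `Vˢ` … local-étale … so that `S₀ˢ` is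
regular"). Frame: `S` Noetherian in an ambient valued field `(E, O_E)`, `M ∋ S` a subfield,
`N | M` finite inside `E`, `Gˢ = decompositionGroupIn O_E N`. Given a finite `t ⊆ N`, stable
under `Gˢ`, with `Mˢ ⊆ Frac S[t]`, `S[t] ⊆ O_E`, `(S[t])_𝔪` regular, and such that every
`τ ∈ Gˢ` either fixes `t` pointwise or moves some element of `(S[t])_𝔪` by a `v`-unit (trivial
inertia of `Gˢ/kernel` on the model), there is a local uniformization of the decomposition field
`Mˢ`: the ring of invariants `S[t]^{Gˢ} = S[t′]` (E. Noether), whose local ring at the centre is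
`((S[t])_𝔪)^{Gˢ}` and is regular by étale descent.
[cite: CossartPiltant2008, proof of Prop. 9.3 (HAL p. 27)] -/
theorem exists_model_decompositionField_of_stableModel [IsNoetherianRing S]
    (OE : ValuationSubring E) (M : Subfield E) (hSM : ∀ s : S, algebraMap S E s ∈ M)
    (N : IntermediateField M E) [FiniteDimensional M N]
    (t : Finset E) (htN : (t : Set E) ⊆ N.toSubfield)
    (hscl : (lift (fixedField (decompositionGroupIn OE N))).toSubfield ≤
      Subfield.closure (Set.range (algebraMap S E) ∪ (t : Set E)))
    (hTO : (Algebra.adjoin S (t : Set E)).toSubring ≤ OE.toSubring)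
    (hreg : IsRegularLocalRing (Localization.AtPrime
      (Ideal.comap (Subring.inclusion hTO) (maximalIdeal OE))))
    (hstab : ∀ τ ∈ decompositionGroupIn OE N, ∀ x : N, (x : E) ∈ t → ((τ x : N) : E) ∈ t)
    (hI : ∀ τ ∈ decompositionGroupIn OE N, (∀ x : N, (x : E) ∈ t → τ x = x) ∨
      ∃ x : N, (x : E) ∈ locAtCentre (Algebra.adjoin S (t : Set E)).toSubring OE ∧
        OE.valuation (((τ x : N) : E) - x) = 1) :
    ∃ t' : Finset E, (t' : Set E) ⊆ (lift (fixedField (decompositionGroupIn OE N))).toSubfield ∧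
      (lift (fixedField (decompositionGroupIn OE N))).toSubfield ≤
        Subfield.closure (Set.range (algebraMap S E) ∪ (t' : Set E)) ∧
      ∃ hTO' : (Algebra.adjoin S (t' : Set E)).toSubring ≤ OE.toSubring,
        IsRegularLocalRing (Localization.AtPrime
          (Ideal.comap (Subring.inclusion hTO') (maximalIdeal OE))) := by
  classical
  /- the field `N` with `O′ = O_E ∩ N`, the base `φ : S → N` and the group `Gˢ` acting on `N` -/
  let ι : N →+* E := algebraMap N E
  have hι : ∀ x : N, ι x = (x : E) := fun _ => rfl
  let O' : ValuationSubring N := OE.comap ι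
  have hO' : ∀ x : N, x ∈ O' ↔ (x : E) ∈ OE := fun _ => Iff.rfl
  let φ : S →+* N := (algebraMap M N).comp ((algebraMap S E).codRestrict M hSM)
  have hφ : ∀ s : S, ((φ s : N) : E) = algebraMap S E s := fun _ => rfl
  let G := ↥(decompositionGroupIn OE N)
  letI : Fintype G := Fintype.ofFinite G
  have hsmul : ∀ (g : G) (x : N), g • x = (g : N ≃ₐ[M] N) x := fun _ _ => rfl
  have hGO : ∀ (g : G) (x : N), x ∈ O' → g • x ∈ O' := fun g x hx =>
    (hO' _).mpr ((((mem_decompositionGroupIn_iff OE N g.1).mp g.2) x).mp ((hO' x).mp hx))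
  have hφG : ∀ (g : G) (s : S), g • φ s = φ s := fun g s => by
    rw [hsmul]
    exact (g : N ≃ₐ[M] N).commutes _
  /- the generators inside `N` -/
  have htN' : ∀ x ∈ t, x ∈ N := fun x hx => htN (Finset.mem_coe.mpr hx)
  let t₀ : Finset N := t.subtype (· ∈ N)
  have ht₀ : ∀ y : N, y ∈ t₀ ↔ (y : E) ∈ t := fun y => Finset.mem_subtype
  have ht₀G : ∀ (g : G), ∀ y ∈ t₀, g • y ∈ t₀ := fun g y hy =>
    (ht₀ _).mpr (by rw [hsmul]; exact hstab g.1 g.2 y ((ht₀ y).mp hy))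
  -- models over `S` inside `N` and their images in `E`
  have hmapcl : ∀ X : Finset N, (Subring.closure (Set.range φ ∪ (X : Set N))).map ι =
      (Algebra.adjoin S ((X.image ι : Finset E) : Set E)).toSubring := by
    intro X
    rw [RingHom.map_closure, Algebra.adjoin_eq_ring_closure, Set.image_union]
    congr 1
    ext x
    simp only [Set.mem_union, Set.mem_image, Set.mem_range, Finset.coe_image]
    constructor
    · rintro (⟨y, ⟨s, rfl⟩, rfl⟩ | ⟨y, hy, rfl⟩)
      · exact Or.inl ⟨s, (hφ s).symm⟩
      · exact Or.inr ⟨y, hy, rfl⟩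
    · rintro (⟨s, rfl⟩ | ⟨y, hy, rfl⟩)
      · exact Or.inl ⟨φ s, ⟨s, rfl⟩, hφ s⟩
      · exact Or.inr ⟨y, hy, rfl⟩
  have ht₀im : t₀.image ι = t := by
    ext x
    simp only [Finset.mem_image]
    constructor
    · rintro ⟨y, hy, rfl⟩
      exact (ht₀ y).mp hy
    · intro hx
      exact ⟨⟨x, htN' x hx⟩, (ht₀ _).mpr hx, rfl⟩
  set T₀N : Subring N := Subring.closure (Set.range φ ∪ (t₀ : Set N)) with hT₀N
  have hT₀map : T₀N.map ι = (Algebra.adjoin S (t : Set E)).toSubring := by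
    rw [hT₀N, hmapcl t₀, ht₀im]
  have hmemT₀ : ∀ y : N, y ∈ T₀N ↔ (y : E) ∈ Algebra.adjoin S (t : Set E) := by
    intro y
    constructor
    · intro hy
      have h : ι y ∈ (Algebra.adjoin S (t : Set E)).toSubring := by
        rw [← hT₀map]; exact ⟨y, hy, rfl⟩
      exact h
    · intro hy
      have h : ι y ∈ T₀N.map ι := by rw [hT₀map]; exact hy
      obtain ⟨y', hy', hyy'⟩ := h
      have : y' = y := (algebraMap N E).injective hyy'
      rw [← this]
      exact hy'
  have hT₀O' : T₀N ≤ O'.toSubring := fun y hy => (hO' y).mpr (hTO ((hmemT₀ y).mp hy))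
  have hT₀G : ∀ (g : G), ∀ y ∈ T₀N, g • y ∈ T₀N := fun g y hy =>
    smul_mem_closure_of_stable φ hφG
      (fun g x hx => Finset.mem_coe.mpr (ht₀G g x (Finset.mem_coe.mp hx))) g hy
  -- the local ring of `S[t]` read in `N` is regular
  have hregN : IsRegularLocalRing (locAtCentre T₀N O') := by
    rw [isRegularLocalRing_locAtCentre_map_iff OE ι T₀N, hT₀map]
    exact (isRegularLocalRing_locAtCentre_iff hTO).mpr hreg
  have hlocmap : (locAtCentre T₀N O').map ι =
      locAtCentre (Algebra.adjoin S (t : Set E)).toSubring OE := by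
    rw [map_locAtCentre_comap OE ι T₀N, hT₀map]
  /- trivial inertia modulo kernel, read in `N` -/
  have hIN : ∀ g : G, (∀ x ∈ T₀N, g • x = x) ∨
      ∃ x ∈ locAtCentre T₀N O', O'.valuation (g • x - x) = 1 := by
    intro g
    rcases hI g.1 g.2 with h | ⟨x, hx, hv⟩
    · left
      have hle : T₀N ≤ (MulSemiringAction.toRingHom G N g).eqLocus (RingHom.id N) := by
        refine Subring.closure_le.mpr ?_
        rintro y (⟨s, rfl⟩ | hy)
        · change g • φ s = φ s
          exact hφG g s
        · change g • y = y
          rw [hsmul]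
          exact h y ((ht₀ y).mp (Finset.mem_coe.mp hy))
      intro x hx
      exact hle hx
    · right
      have hx' : ι x ∈ (locAtCentre T₀N O').map ι := by rw [hlocmap]; exact hx
      obtain ⟨x', hx'mem, hxx'⟩ := hx'
      have hxeq : x' = x := (algebraMap N E).injective hxx'
      refine ⟨x, hxeq ▸ hx'mem, ?_⟩
      rw [valuation_comap_ringHom_eq_one_iff OE ι, map_sub]
      exact hv
  /- "`S₀ˢ` is regular": the fixed local model is regular -/
  have hregFix : IsRegularLocalRing (locAtCentre (T₀N ⊓ FixedPoints.subring N G) O') :=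
    isRegularLocalRing_locAtCentre_inf_fixedPoints O' hGO hT₀O' hT₀G hIN hregN
  /- "`S₀ˢ` is a model": E. Noether -/
  obtain ⟨t₁, ht₁G, ht₁cl⟩ := exists_finset_closure_eq_inf_fixedPoints φ hφG t₀ ht₀G
  have hT₁map : (Subring.closure (Set.range φ ∪ (t₁ : Set N))).map ι =
      (Algebra.adjoin S ((t₁.image ι : Finset E) : Set E)).toSubring := hmapcl t₁
  have hTO' : (Algebra.adjoin S ((t₁.image ι : Finset E) : Set E)).toSubring ≤ OE.toSubring := by
    intro x hx
    rw [← hT₁map] at hx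
    obtain ⟨y, hy, rfl⟩ := hx
    rw [ht₁cl] at hy
    exact hT₀O' hy.1
  refine ⟨t₁.image ι, ?_, ?_, hTO', ?_⟩
  · -- `t′ ⊆ Mˢ`
    intro x hx
    obtain ⟨y, hy, rfl⟩ := Finset.mem_image.mp (Finset.mem_coe.mp hx)
    change (y : E) ∈ (lift (fixedField (decompositionGroupIn OE N))).toSubfield
    rw [IntermediateField.mem_toSubfield]
    refine (IntermediateField.mem_lift y).mpr ((mem_fixedField_iff _ y).mpr fun τ hτ => ?_)
    have h := ht₁G y hy ⟨τ, hτ⟩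
    rwa [hsmul] at h
  · -- `Mˢ ⊆ Frac S[t′]`
    intro x hx
    have hx' : x ∈ lift (fixedField (decompositionGroupIn OE N)) := hx
    have hxN : x ∈ N := lift_le _ hx'
    set xN : N := ⟨x, hxN⟩ with hxNdef
    have hxfix : ∀ g : G, g • xN = xN := fun g => by
      rw [hsmul]
      have h1 : xN ∈ fixedField (decompositionGroupIn OE N) :=
        (IntermediateField.mem_lift xN).mp hx'
      exact (mem_fixedField_iff _ xN).mp h1 g.1 g.2
    -- `x ∈ Frac S[t]` read in `N`
    have hxfrac : xN ∈ Subfield.closure (T₀N : Set N) := by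
      have hle : Subfield.closure (Set.range (algebraMap S E) ∪ (t : Set E)) ≤
          (Subfield.closure (T₀N : Set N)).map ι := by
        rw [Subfield.closure_le]
        rintro z (⟨s, rfl⟩ | hz)
        · exact ⟨φ s, Subfield.subset_closure (Subring.subset_closure (Or.inl ⟨s, rfl⟩)), hφ s⟩
        · exact ⟨⟨z, htN' z hz⟩, Subfield.subset_closure
            (Subring.subset_closure (Or.inr (Finset.mem_coe.mpr ((ht₀ _).mpr hz)))), rfl⟩
      obtain ⟨y', hy', hyy'⟩ := hle (hscl hx)
      have : y' = xN := (algebraMap N E).injective hyy'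
      rw [← this]
      exact hy'
    have hxfrac' := mem_subfieldClosure_inf_fixedPoints_of_smul_eq hT₀G hxfrac hxfix
    rw [← ht₁cl] at hxfrac'
    -- back to `E`
    have hle : Subfield.closure ((Subring.closure (Set.range φ ∪ (t₁ : Set N)) : Subring N) : Set N) ≤
        (Subfield.closure (Set.range (algebraMap S E) ∪ ((t₁.image ι : Finset E) : Set E))).comap ι := by
      rw [Subfield.closure_le]
      change Subring.closure (Set.range φ ∪ (t₁ : Set N)) ≤
        ((Subfield.closure (Set.range (algebraMap S E) ∪
          ((t₁.image ι : Finset E) : Set E))).comap ι).toSubring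
      refine Subring.closure_le.mpr ?_
      rintro z (⟨s, rfl⟩ | hz)
      · exact Subfield.subset_closure (Or.inl ⟨s, (hφ s).symm⟩)
      · exact Subfield.subset_closure (Or.inr (Finset.mem_coe.mpr
          (Finset.mem_image.mpr ⟨z, Finset.mem_coe.mp hz, rfl⟩)))
    exact hle hxfrac'
  · -- regular at the centre
    refine (isRegularLocalRing_locAtCentre_iff hTO').mp ?_
    rw [← hT₁map, ← isRegularLocalRing_locAtCentre_map_iff OE ι, ht₁cl]
    exact hregFix

/-- **Cossart–Piltant 2019, Prop. 4.10 from Thm. 1.5, principalization, resolution of excellent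
surfaces (embedded and non-embedded), "S is stable by G" in BOTH layers, and the decomposition
layer of [CoP1] Prop. 9.3**: `cossartPiltant2019ReductionP_of_cjs_of_layers` with its inertia
layer `hInert` DISCHARGED from `hStabInert` — a `Gˢ`-stable local uniformization with trivial
inertia modulo kernel in the inertia layer — by `exists_model_decompositionField_of_stableModel`
(étale descent of invariants + E. Noether). After this theorem the transfer part (C3)+(C4)+(C5)
of the printed reduction `Thm. 1.5 ⇒ Thm. 1.1` rests on `hDec` ([CoP1] Prop. 9.3 for `K′ ≤ Mˢ`,
whose printed proof — density, Prop. 8.1, ZMT — is complete) and on ONE unprinted principle,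
equivariant local uniformization, in its two instances `hStabLoc` (tame Kummer layer, Lemma 9.4:
"S is stable by G") and `hStabInert` (inertia layer of Prop. 9.3: "`S₀ⁱ` … the invariant ring
`S₀ˢ := (S₀ⁱ)^{Gˢ/Gⁱ}`").
[cite: CossartPiltant2019, Props. 4.3, 4.4 and proof of Prop. 4.10 (arXiv v1: Props. 4.2, 4.3, 4.8, pp. 50–54)]
[cite: CossartPiltant2008, Lemma 9.4, Prop. 9.3, Prop. 9.5 (HAL pp. 26–30)]
[cite: CossartJannsenSaito2020, Thm. 1.2, Cor. 1.5] -/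
theorem cossartPiltant2019ReductionP_of_cjs_of_stableLayers
    (hloc : CossartPiltant2019Local.{u}) (h44 : CossartPiltant2019Principalization.{u})
    (hCJS : CossartJannsenSaito2020General.{u})
    (hEmb : ∀ (Z : Scheme.{u}) [IsIntegral Z] [IsNoetherian Z], Scheme.IsRegular Z →
      Scheme.IsExcellent Z → ∀ (X : Set Z), IsClosed X → X ≠ Set.univ → topologicalKrullDim X ≤ 2 →
        ∃ (Z' : Scheme.{u}) (π : Z' ⟶ Z), IsProper π ∧ Function.Surjective π.base ∧
          (∃ U : Z.Opens, (U : Set Z) = Xᶜ ∧ IsIso (π ∣_ U)) ∧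
          IsStrictNormalCrossingsDivisor Z' (π.base ⁻¹' X))
    (hStabLoc :
      ∀ (p : ℕ), p.Prime →
      ∀ (S : Type u) [CommRing S] [IsDomain S] [IsRegularLocalRing S],
        IsExcellentRing S → ringKrullDim S = 3 → CharP (ResidueField S) p →
        IsAdicComplete (maximalIdeal S) S →
      ∀ (E : Type u) [Field E] [Algebra S E], Function.Injective (algebraMap S E) →
        IsAlgClosed E → Algebra.IsAlgebraic S E →
      ∀ (OE : ValuationSubring E), (∀ s : S, algebraMap S E s ∈ OE) →
        (∀ s ∈ maximalIdeal S, OE.valuation (algebraMap S E s) < 1) →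
        (∀ y : OE, ∃ q : S[X], (∃ i, q.coeff i ∉ maximalIdeal S) ∧
          OE.valuation (q.eval₂ (algebraMap S E) y) < 1) →
      Nonempty OE.valuation.RankOne →
      ∀ (ℓ : ℕ), ℓ.Prime → ℓ ≠ p → ∀ (ζ : E), IsPrimitiveRoot ζ ℓ →
      ∀ (A : Subfield E), (∀ s : S, algebraMap S E s ∈ A) → ζ ∈ A →
      ∀ (θ : E), θ ∉ A → θ ^ ℓ ∈ A → OE.valuation θ ≤ 1 →
        Module.finrank A (adjoin A ({θ} : Set E)) = ℓ → IsGalois A (adjoin A ({θ} : Set E)) →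
        inertiaGroupIn OE (adjoin A ({θ} : Set E)) = ⊤ →
        (∃ t : Finset E, (t : Set E) ⊆ (adjoin A ({θ} : Set E)).toSubfield ∧
          (adjoin A ({θ} : Set E)).toSubfield ≤
            Subfield.closure (Set.range (algebraMap S E) ∪ (t : Set E)) ∧
          ∃ hTO : (Algebra.adjoin S (t : Set E)).toSubring ≤ OE.toSubring,
            IsRegularLocalRing (Localization.AtPrime
              (Ideal.comap (Subring.inclusion hTO) (maximalIdeal OE)))) →
        (∃ t : Finset E, (t : Set E) ⊆ (adjoin A ({θ} : Set E)).toSubfield ∧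
          (adjoin A ({θ} : Set E)).toSubfield ≤
            Subfield.closure (Set.range (algebraMap S E) ∪ (t : Set E)) ∧
          ∃ hTO : (Algebra.adjoin S (t : Set E)).toSubring ≤ OE.toSubring,
            IsRegularLocalRing (Localization.AtPrime
              (Ideal.comap (Subring.inclusion hTO) (maximalIdeal OE))) ∧
            ∀ (τ : adjoin A ({θ} : Set E) ≃ₐ[A] adjoin A ({θ} : Set E))
              (x : adjoin A ({θ} : Set E)),
              (x : E) ∈ locAtCentre (Algebra.adjoin S (t : Set E)).toSubring OE →
              ((τ x : adjoin A ({θ} : Set E)) : E) ∈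
                locAtCentre (Algebra.adjoin S (t : Set E)).toSubring OE))
    (hStabInert :
      ∀ (p : ℕ), p.Prime →
      ∀ (S : Type u) [CommRing S] [IsDomain S] [IsRegularLocalRing S],
        IsExcellentRing S → ringKrullDim S = 3 → CharP (ResidueField S) p →
        IsAdicComplete (maximalIdeal S) S →
      ∀ (E : Type u) [Field E] [Algebra S E], Function.Injective (algebraMap S E) →
        IsAlgClosed E → Algebra.IsAlgebraic S E →
      ∀ (OE : ValuationSubring E), (∀ s : S, algebraMap S E s ∈ OE) →
        (∀ s ∈ maximalIdeal S, OE.valuation (algebraMap S E s) < 1) →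
        (∀ y : OE, ∃ q : S[X], (∃ i, q.coeff i ∉ maximalIdeal S) ∧
          OE.valuation (q.eval₂ (algebraMap S E) y) < 1) →
      Nonempty OE.valuation.RankOne →
      ∀ (M : Subfield E), (∀ s : S, algebraMap S E s ∈ M) →
      ∀ (N : IntermediateField M E) [FiniteDimensional M N] [IsGalois M N] (K' : Subfield E),
        (lift (fixedField (decompositionGroupIn OE N))).toSubfield ≤ K' →
        K' ≤ (lift (fixedField (inertiaGroupIn OE N))).toSubfield →
        (∃ t : Finset E, (t : Set E) ⊆ K' ∧
          K' ≤ Subfield.closure (Set.range (algebraMap S E) ∪ (t : Set E)) ∧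
          ∃ hTO : (Algebra.adjoin S (t : Set E)).toSubring ≤ OE.toSubring,
            IsRegularLocalRing (Localization.AtPrime
              (Ideal.comap (Subring.inclusion hTO) (maximalIdeal OE)))) →
        ∃ t : Finset E, (t : Set E) ⊆ N.toSubfield ∧
          (lift (fixedField (decompositionGroupIn OE N))).toSubfield ≤
            Subfield.closure (Set.range (algebraMap S E) ∪ (t : Set E)) ∧
          ∃ hTO : (Algebra.adjoin S (t : Set E)).toSubring ≤ OE.toSubring,
            IsRegularLocalRing (Localization.AtPrime
              (Ideal.comap (Subring.inclusion hTO) (maximalIdeal OE))) ∧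
            (∀ τ ∈ decompositionGroupIn OE N, ∀ x : N, (x : E) ∈ t → ((τ x : N) : E) ∈ t) ∧
            (∀ τ ∈ decompositionGroupIn OE N, (∀ x : N, (x : E) ∈ t → τ x = x) ∨
              ∃ x : N, (x : E) ∈ locAtCentre (Algebra.adjoin S (t : Set E)).toSubring OE ∧
                OE.valuation (((τ x : N) : E) - x) = 1))
    (hDec :
      ∀ (p : ℕ), p.Prime →
      ∀ (S : Type u) [CommRing S] [IsDomain S] [IsRegularLocalRing S],
        IsExcellentRing S → ringKrullDim S = 3 → CharP (ResidueField S) p →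
        IsAdicComplete (maximalIdeal S) S →
      ∀ (E : Type u) [Field E] [Algebra S E], Function.Injective (algebraMap S E) →
        IsAlgClosed E → Algebra.IsAlgebraic S E →
      ∀ (OE : ValuationSubring E), (∀ s : S, algebraMap S E s ∈ OE) →
        (∀ s ∈ maximalIdeal S, OE.valuation (algebraMap S E s) < 1) →
        (∀ y : OE, ∃ q : S[X], (∃ i, q.coeff i ∉ maximalIdeal S) ∧
          OE.valuation (q.eval₂ (algebraMap S E) y) < 1) →
      Nonempty OE.valuation.RankOne →
      ∀ (M : Subfield E), (∀ s : S, algebraMap S E s ∈ M) →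
      ∀ (N : IntermediateField M E) [FiniteDimensional M N] [IsGalois M N] (K' : Subfield E),
        M ≤ K' → K' ≤ (lift (fixedField (decompositionGroupIn OE N))).toSubfield →
        (∃ t : Finset E, (t : Set E) ⊆ K' ∧
          K' ≤ Subfield.closure (Set.range (algebraMap S E) ∪ (t : Set E)) ∧
          ∃ hTO : (Algebra.adjoin S (t : Set E)).toSubring ≤ OE.toSubring,
            IsRegularLocalRing (Localization.AtPrime
              (Ideal.comap (Subring.inclusion hTO) (maximalIdeal OE)))) →
        (∃ t : Finset E, (t : Set E) ⊆ M ∧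
          M ≤ Subfield.closure (Set.range (algebraMap S E) ∪ (t : Set E)) ∧
          ∃ hTO : (Algebra.adjoin S (t : Set E)).toSubring ≤ OE.toSubring,
            IsRegularLocalRing (Localization.AtPrime
              (Ideal.comap (Subring.inclusion hTO) (maximalIdeal OE))))) :
    CossartPiltant2019ReductionP.{u} :=
  cossartPiltant2019ReductionP_of_cjs_of_layers hloc h44 hCJS hEmb hStabLoc
    (fun p hp S _ _ _ hS hSdim hSchar hScomp E _ _ hinj hE halg OE hSO hdom hres hrk M hSM N _ _ K'
        hsK' hK'i hLUK' => by
      obtain ⟨t, htN, hscl, hTO, hreg, hstab, hI⟩ := hStabInert p hp S hS hSdim hSchar hScomp E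
        hinj hE halg OE hSO hdom hres hrk M hSM N K' hsK' hK'i hLUK'
      exact exists_model_decompositionField_of_stableModel OE M hSM N t htN hscl hTO hreg hstab hI)
    hDec

end InertiaStable

end Literature.AlgebraicGeometry.Resolution

end
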